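/-
Copyright (c) 2026. Released under Apache 2.0 license.
-/
import Literature.Combinatorics.Words.Borders
import Literature.Computability.StringMatching.SuffixArray
import HarnessLib

/-!
# MS-factorisation of a word: the maximal suffix and the periods of the whole word

Source: M. Crochemore, W. Rytter, *Text Algorithms*, Oxford University Press (1994), §13.6
"One-way matching and magic decomposition", Lemmas 13.15 and 13.16, and the bibliographic notes of
Chapter 13 (§13.6 is from M. Crochemore, *String-matching on ordered alphabets*, Theoret. Comput. Sci.
92 (1992) 33–47). [CrochemoreRytter1994] [Crochemore1992]

Let `x = u v` be a nonempty word and `v = Maxsuf(x)` its lexicographically maximal suffix.  With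
`p = period(v)`, `w = v[0..p)` (so `v = wᵉ w'`, `e = ⌊|v|/p⌋ ≥ 1`, `|w'| < |w|`) the sequence
`(u, w, e, w')` is the **MS-factorisation** of `x`.  This file proves the combinatorial facts that
make the one-way ("magic") string-matching algorithms of §13.6 correct:

* `IsMaxSuffix x v` — the predicate "`v` is the maximal suffix of `x`" (for a linear order on the
  letters), decidable; existence `exists_isMaxSuffix`, uniqueness `IsMaxSuffix.unique`,
  `IsMaxSuffix.ne_nil`, restriction to intermediate suffixes `IsMaxSuffix.of_suffix` (in particular
  a maximal suffix is *self-maximal*, `IsMaxSuffix.self`).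
* `IsMaxSuffix.not_prefix_of_suffix` — the key step of both lemmas: no nonempty suffix `z` of `u`
  is a prefix of `v` (else `z v` would be a suffix of `x` greater than `v`).
* Lemma 13.15: (1) `IsMaxSuffix.not_hasPeriod_take_minPeriod`, `IsMaxSuffix.minPeriod_take_minPeriod`
  (the word `w` is border-free); (2) `IsMaxSuffix.suffix_take_minPeriod_iff` (`u` is a suffix of `w`
  **iff** `period(x) = period(v)`; the book states "⇒", the converse is implicit in §13.6),
  `minPeriod_le_minPeriod_append`, `IsMaxSuffix.minPeriod_lt_minPeriod_of_not_suffix`;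
  (3) `IsMaxSuffix.length_lt_minPeriod` (`period(x) > |u|`);
  (4) `IsMaxSuffix.length_lt_minPeriod_of_minPeriod_le` (`|u| ≥ period(v) ⟹ period(x) > |v|`);
  (5) `IsMaxSuffix.min_lt_minPeriod` (`u` not a suffix of `w`, `|u| < period(v) ⟹
  period(x) > min(|v|, |u wᵉ|)`).
* Lemma 13.16: `IsMaxSuffix.max_lt_minPeriod` (`period(x) > max(|u|, min(|v|, |u wᵉ|))`) and
  `IsMaxSuffix.length_lt_two_mul_minPeriod` (this maximum is `≥ |x|/2`, so `|x| < 2 period(x)`: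
  after a complete match the shift of Algorithm 13.6 is `≥ |x|/2`); the contrapositive used by the
  two-way / one-way matchers, `IsMaxSuffix.suffix_take_minPeriod_of_two_mul_le`: if
  `2 period(x) ≤ |x|` then `u` is a suffix of `w` and `period(x) = period(v)`.
* The examples of §13.6 showing that the bounds of Lemma 13.15 are attained (`aaaaba`, `aababa`,
  `acabca`, `ababbbab`) and the example `babbbabbbab` of informal algorithm P, checked by `decide`
  (letters `a < b < c` are `0 < 1 < 2 : ℕ`; smallest periods through
  `minPeriod_eq_length_sub_length_border`).

Not formalised here: the algorithms MS, P, Per, Simple-Text-Search and SpecialCase-TS of §13.6 and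
their complexity statements (Lemmas 13.13, 13.14, 13.17, Theorems 13.18, 13.19); only their
combinatorial basis above.  The maximal suffix is used through the predicate `IsMaxSuffix`, so the
lemmas apply verbatim to the maximal suffix for the reversed alphabet ordering (apply them in
`αᵒᵈ`); for the function `maxSuffix` of `Literature.Combinatorics.Words.CriticalFactorization`
(§13.5, Theorem 13.12) one has `IsMaxSuffix x v ↔ maxSuffix x = v` by `maxSuffix_eq_iff` there (that
module is not imported here).

Conventions: words are `List α`; `<:+`, `<+:`, `<:+:` are suffix / prefix / factor; `List.HasPeriod`
and `minPeriod` (`Literature.Combinatorics.Words.FineWilf`) are the period predicate and the smallest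
period (`minPeriod [] = 1`); the list order is the lexicographic one of Mathlib (`List.Lex`), for
which a proper prefix is smaller.
-/

namespace Literature.Combinatorics.Words

open List Nat
open Literature.Computability.StringMatching (lcp lcp_prefix_left lcp_prefix_right
  getElem?_eq_of_lt_length_lcp lt_iff_lcp lt_of_prefix_of_length_lt lt_of_getElem?_lt
  append_lt_append_iff_of_length_eq)

variable {α : Type*}

/-! ### Two index computations on periodic words -/

section Periodic

/-- If `u v` has a period `q` with `|u| ≤ q ≤ |v|` then `u` occurs in `v` at position `q - |u|`:
`u[i] = v[q - |u| + i]`. [folklore] -/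
private theorem getElem?_eq_of_hasPeriod_append {u v : List α} {q : ℕ} (hq : (u ++ v).HasPeriod q)
    (hqu : u.length ≤ q) (hqv : q ≤ v.length) {i : ℕ} (hi : i < u.length) :
    u[i]? = v[q - u.length + i]? := by
  have h := List.hasPeriod_iff_getElem?.mp hq i (by rw [List.length_append]; omega)
  rw [List.getElem?_append_left hi, List.getElem?_append_right (by omega)] at h
  rw [h]; congr 1; omega

/-- If `v` has period `p`, `u` occurs in `v` at position `o` and `m` is a multiple of `p` with
`o ≤ m < o + |u| ≤ |v|`, then `z = v[m..o+|u|)` is a nonempty suffix of `u` and (by `p`-periodicity)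
a prefix of `v`. [folklore] -/
private theorem exists_suffix_prefix_of_hasPeriod {u v : List α} {p o m : ℕ} (hp : v.HasPeriod p)
    (hocc : ∀ i < u.length, u[i]? = v[o + i]?) (hpm : p ∣ m) (hom : o ≤ m)
    (hmu : m < o + u.length) (huv : o + u.length ≤ v.length) :
    ∃ z : List α, z ≠ [] ∧ z <:+ u ∧ z <+: v := by
  refine ⟨u.drop (m - o), ?_, List.drop_suffix _ _, ?_⟩
  · intro h
    have := congrArg List.length h
    rw [List.length_drop, List.length_nil] at this
    omega
  · have hmod := List.hasPeriod_iff_forall_getElem?_mod.mp hp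
    obtain ⟨c, rfl⟩ := hpm
    rw [List.prefix_iff_eq_take]
    apply List.ext_getElem?
    intro j
    rw [List.getElem?_drop, List.getElem?_take, List.length_drop]
    by_cases hj : j < u.length - (p * c - o)
    · rw [if_pos hj, hocc _ (by omega), show o + (p * c - o + j) = j + p * c by omega,
        hmod (j + p * c) (by omega), hmod j (by omega), Nat.add_mul_mod_self_left]
    · rw [if_neg hj]
      exact List.getElem?_eq_none (by omega)

end Periodic

section MaxSuffix

variable [LinearOrder α]

/-! ### The maximal suffix as a predicate -/

/-- `IsMaxSuffix x v`: `v` is the (lexicographically) **maximal suffix** of `x`, `v = Maxsuf(x)`.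
[cite: CrochemoreRytter1994, §13.6 (MS-factorization, v = Maxsuf(x))] -/
def IsMaxSuffix (x v : List α) : Prop :=
  v <:+ x ∧ ∀ s : List α, s <:+ x → s ≤ v

/-- `IsMaxSuffix` through the finite list of suffixes `x.tails`.
[cite: CrochemoreRytter1994, §13.6 (MS-factorization, v = Maxsuf(x))] -/
theorem isMaxSuffix_iff_tails {x v : List α} :
    IsMaxSuffix x v ↔ v ∈ x.tails ∧ ∀ s ∈ x.tails, s ≤ v := by
  simp only [IsMaxSuffix, List.mem_tails]

/-- `IsMaxSuffix x v` is decidable (used by the `decide` examples below). [folklore] -/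
instance instDecidableIsMaxSuffix (x v : List α) : Decidable (IsMaxSuffix x v) :=
  decidable_of_iff _ isMaxSuffix_iff_tails.symm

/-- The maximal suffix is a suffix. [cite: CrochemoreRytter1994, §13.6 (MS-factorization, v = Maxsuf(x))] -/
theorem IsMaxSuffix.suffix {x v : List α} (h : IsMaxSuffix x v) : v <:+ x := h.1

/-- Every suffix is `≤` the maximal suffix. [cite: CrochemoreRytter1994, §13.6 (MS-factorization, v = Maxsuf(x))] -/
theorem IsMaxSuffix.le {x v s : List α} (h : IsMaxSuffix x v) (hs : s <:+ x) : s ≤ v := h.2 s hs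

/-- **Existence** of the maximal suffix. [cite: CrochemoreRytter1994, §13.6 (MS-factorization, v = Maxsuf(x))] -/
theorem exists_isMaxSuffix : ∀ x : List α, ∃ v, IsMaxSuffix x v
  | [] => ⟨[], List.suffix_refl _, fun s hs => by rw [List.suffix_nil.mp hs]⟩
  | a :: x => by
    obtain ⟨v, hv, hmax⟩ := exists_isMaxSuffix x
    by_cases h : v ≤ a :: x
    · refine ⟨a :: x, List.suffix_refl _, fun s hs => ?_⟩
      rcases List.suffix_cons_iff.mp hs with rfl | hs
      · exact le_rfl
      · exact (hmax s hs).trans h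
    · refine ⟨v, hv.trans (List.suffix_cons a x), fun s hs => ?_⟩
      rcases List.suffix_cons_iff.mp hs with rfl | hs
      · exact (not_le.mp h).le
      · exact hmax s hs

/-- **Uniqueness** of the maximal suffix. [cite: CrochemoreRytter1994, §13.6 (MS-factorization, v = Maxsuf(x))] -/
theorem IsMaxSuffix.unique {x v v' : List α} (h : IsMaxSuffix x v) (h' : IsMaxSuffix x v') :
    v = v' :=
  le_antisymm (h'.2 _ h.1) (h.2 _ h'.1)

/-- `Maxsuf(x) ≠ ε` for `x ≠ ε`. [cite: CrochemoreRytter1994, §13.6 (MS-factorization, v = Maxsuf(x))] -/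
theorem IsMaxSuffix.ne_nil {x v : List α} (h : IsMaxSuffix x v) (hx : x ≠ []) : v ≠ [] := by
  intro h0
  have hle := h.2 x (List.suffix_refl x)
  rw [h0] at hle
  rcases x with _ | ⟨a, x⟩
  · exact hx rfl
  · exact absurd (List.nil_lt_cons a x) (not_lt.mpr hle)

/-- `x = u · Maxsuf(x)` with `u = x[0..|x|-|v|)`. [cite: CrochemoreRytter1994, §13.6 (MS-factorization, x = uv)] -/
theorem IsMaxSuffix.take_append {x v : List α} (h : IsMaxSuffix x v) :
    x.take (x.length - v.length) ++ v = x := by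
  conv_rhs => rw [← List.take_append_drop (x.length - v.length) x]
  rw [← (List.suffix_iff_eq_drop.mp h.1)]

/-- The maximal suffix of `x` is the maximal suffix of every suffix `y` of `x` containing it; in
particular `Maxsuf(v) = v` (`v` is self-maximal). [cite: CrochemoreRytter1994, §13.6 (MS-factorization, v = Maxsuf(x))] -/
theorem IsMaxSuffix.of_suffix {x y v : List α} (h : IsMaxSuffix x v) (hy : y <:+ x) (hvy : v <:+ y) :
    IsMaxSuffix y v :=
  ⟨hvy, fun s hs => h.2 s (hs.trans hy)⟩

/-- A maximal suffix is self-maximal: `Maxsuf(v) = v`. [cite: CrochemoreRytter1994, §13.6 (MS-factorization, v = Maxsuf(x))] -/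
theorem IsMaxSuffix.self {x v : List α} (h : IsMaxSuffix x v) : IsMaxSuffix v v :=
  h.of_suffix h.1 (List.suffix_refl v)

/-- **Key step** ("`zv` is a suffix of `x` greater than `v`", proofs of Lemma 13.15 (4), (5) and of
Theorem 13.12): if `v = Maxsuf(x)` and `z v` is a suffix of `x` with `z ≠ ε`, then `z` is not a prefix
of `v`. [cite: CrochemoreRytter1994, Lemma 13.15 (proof of (4))] -/
theorem IsMaxSuffix.not_prefix_of_append_suffix {x v z : List α} (hv : IsMaxSuffix x v) (hz : z ≠ [])
    (hzx : z ++ v <:+ x) : ¬ z <+: v := by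
  rintro ⟨t, rfl⟩
  have h1 : z ++ (z ++ t) ≤ z ++ t := hv.2 _ hzx
  have h2 : t ≤ z ++ t := hv.2 t ((List.suffix_append z t).trans hv.1)
  have h3 : ¬ t < z ++ t := fun hlt =>
    (not_lt.mpr h1) ((append_lt_append_iff_of_length_eq (u := z) (u' := z) t (z ++ t) rfl).mpr
      (Or.inr ⟨rfl, hlt⟩))
  have h4 : t = z ++ t := le_antisymm h2 (not_lt.mp h3)
  have h5 := congrArg List.length h4
  rw [List.length_append] at h5
  exact hz (List.eq_nil_of_length_eq_zero (by omega))

/-- The key step for `x = u v`, `v = Maxsuf(x)`: no nonempty suffix of `u` is a prefix of `v`.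
[cite: CrochemoreRytter1994, Lemma 13.15 (proof of (4))] -/
theorem IsMaxSuffix.not_prefix_of_suffix {u v z : List α} (hv : IsMaxSuffix (u ++ v) v)
    (hz : z ≠ []) (hzu : z <:+ u) : ¬ z <+: v := by
  obtain ⟨t, rfl⟩ := hzu
  exact hv.not_prefix_of_append_suffix hz ⟨t, (List.append_assoc t z v).symm⟩

/-! ### Lemma 13.15 (3): `period(x) > |u|` -/

/-- **Lemma 13.15 (3)**: if `x = u v` with `v = Maxsuf(x)` then `period(x) > |u|` (a period
`q ≤ |u|` would make `v` a proper prefix of the suffix `x[|u|-q..]`, which is then greater than `v`).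
[cite: CrochemoreRytter1994, Lemma 13.15 (3)] -/
theorem IsMaxSuffix.length_lt_minPeriod {u v : List α} (hv : IsMaxSuffix (u ++ v) v) :
    u.length < minPeriod (u ++ v) := by
  obtain ⟨hq0, hq, -⟩ := minPeriod_spec (u ++ v)
  set q := minPeriod (u ++ v) with hq_def
  by_contra hle
  push Not at hle
  have hper := List.hasPeriod_iff_getElem?.mp hq
  have hpre : v <+: (u ++ v).drop (u.length - q) := by
    rw [List.prefix_iff_eq_take]
    apply List.ext_getElem?
    intro i
    rw [List.getElem?_take, List.getElem?_drop]
    by_cases hi : i < v.length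
    · rw [if_pos hi]
      have h1 := hper (u.length - q + i) (by rw [List.length_append]; omega)
      rw [h1, show u.length - q + i + q = u.length + i by omega,
        List.getElem?_append_right (by omega), Nat.add_sub_cancel_left]
    · rw [if_neg hi]
      exact List.getElem?_eq_none (not_lt.mp hi)
  have hlt : v < (u ++ v).drop (u.length - q) :=
    lt_of_prefix_of_length_lt hpre (by rw [List.length_drop, List.length_append]; omega)
  exact absurd hlt (not_lt.mpr (hv.2 _ (List.drop_suffix _ _)))

/-! ### Lemma 13.15 (1): `w = v[0..period(v))` is border-free -/

/-- A lexicographic step used for Lemma 13.15 (1): if `t` is a prefix of `v`, `t < r` and `t` is not a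
prefix of `r`, then `v < r` (the first difference of `t, r` is a difference of `v, r`). [folklore] -/
private theorem lt_of_prefix_of_lt_of_not_prefix {t r v : List α} (htv : t <+: v) (htr : t < r)
    (hnp : ¬ t <+: r) : v < r := by
  rcases lt_iff_lcp.mp htr with ⟨hlen, -⟩ | ⟨a, b, ha, hb, hab⟩
  · exact absurd (((lcp_prefix_left t r).eq_of_length hlen) ▸ lcp_prefix_right t r) hnp
  · have hm : (lcp t r).length < t.length := by
      by_contra h
      rw [List.getElem?_eq_none (not_lt.mp h)] at ha
      exact absurd ha (by simp)
    obtain ⟨t₂, rfl⟩ := htv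
    refine (lt_of_getElem?_lt (k := (lcp t r).length) (fun j hj => ?_) ?_ hb hab).1
    · rw [List.getElem?_append_left (hj.trans hm)]
      exact getElem?_eq_of_lt_length_lcp hj
    · rw [List.getElem?_append_left hm, ha]

/-- **Lemma 13.15 (1)**: if `v` is self-maximal (`Maxsuf(v) = v`, e.g. `v = Maxsuf(x)`) and
`p = period(v)`, then the prefix `w = v[0..p)` is **border-free**: it has no period `0 < d < p`
(a border `z` of `w`, `w = z''z`, would make the proper suffix `s = z w^{e-1} w'` of `v` greater than
`v`). [cite: CrochemoreRytter1994, Lemma 13.15 (1)] -/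
theorem IsMaxSuffix.not_hasPeriod_take_minPeriod {v : List α} (hv : IsMaxSuffix v v) {d : ℕ}
    (hd : 0 < d) (hdp : d < minPeriod v) : ¬ (v.take (minPeriod v)).HasPeriod d := by
  obtain ⟨hp0, hp, hpmin⟩ := minPeriod_spec v
  intro hwd
  have hv0 : v ≠ [] := by
    rintro rfl
    have := hpmin 1 one_pos (List.hasPeriod_empty 1)
    omega
  have hpl : minPeriod v ≤ v.length := minPeriod_le_length hv0
  set p := minPeriod v with hp_def
  -- `w = v[0..p)`, `t = v[p..)` (a prefix of `v` by `p`-periodicity), `z = w[d..)` (a border of `w`),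
  -- `r = v[p-d..)`: we show `t < r`, `t` not a prefix of `r`, hence `v < r`, contradicting `r ≤ v`.
  have hwl : (v.take p).length = p := by rw [List.length_take, min_eq_left hpl]
  have htv : v.drop p <+: v := (hasPeriod_iff_drop_prefix v p).mp hp
  -- the border: `w[d..) = w[0..p-d)`
  have hz : (v.take p).drop d = (v.take p).take (p - d) := by
    have h := List.prefix_iff_eq_take.mp hwd.drop_prefix
    rwa [List.length_drop, hwl] at h
  -- `v[d..) = z ++ t` and `v = z ++ r` with `r = v[p-d..)`
  have hs : v.drop d = (v.take p).take (p - d) ++ v.drop p := by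
    rw [← hz, ← List.drop_append_of_le_length (by rw [hwl]; exact hdp.le), List.take_append_drop]
  have hvzr : v = (v.take p).take (p - d) ++ v.drop (p - d) := by
    rw [List.take_take, min_eq_left (Nat.sub_le p d), List.take_append_drop]
  have hr : v.drop p = (v.drop (p - d)).drop d := by
    rw [List.drop_drop, show p - d + d = p by omega]
  -- maximality: `v[d..) ≤ v`, i.e. `z ++ t ≤ z ++ r`, so `¬ r < t`
  have h1 : v.drop d ≤ v := hv.2 _ (List.drop_suffix d v)
  have h2 : ¬ v.drop (p - d) < v.drop p := by
    intro hlt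
    have h := (append_lt_append_iff_of_length_eq (u := (v.take p).take (p - d))
      (u' := (v.take p).take (p - d)) (v.drop (p - d)) (v.drop p) rfl).mpr (Or.inr ⟨rfl, hlt⟩)
    rw [← hs, ← hvzr] at h
    exact absurd h (not_lt.mpr h1)
  -- `t` is not a prefix of `r`: else `v[d..)` is a prefix of `v`, a period `d < p` of `v`
  have h3 : ¬ v.drop p <+: v.drop (p - d) := by
    intro hpre
    have : v.drop d <+: v := by
      rw [hs]
      conv_rhs => rw [hvzr]
      exact (List.prefix_append_right_inj _).mpr hpre
    have := hpmin d hd ((hasPeriod_iff_drop_prefix v d).mpr this)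
    omega
  have h4 : v.drop p < v.drop (p - d) := by
    rcases lt_trichotomy (v.drop p) (v.drop (p - d)) with h | h | h
    · exact h
    · exact absurd (h ▸ List.prefix_refl _) h3
    · exact absurd h h2
  have h5 : v < v.drop (p - d) := lt_of_prefix_of_lt_of_not_prefix htv h4 h3
  exact absurd h5 (not_lt.mpr (hv.2 _ (List.drop_suffix _ _)))

/-- **Lemma 13.15 (1)**, period form: `period(w) = |w| = period(v)` for `w = v[0..period(v))`,
`v ≠ ε` self-maximal. [cite: CrochemoreRytter1994, Lemma 13.15 (1)] -/
theorem IsMaxSuffix.minPeriod_take_minPeriod {v : List α} (hv : IsMaxSuffix v v) (hv0 : v ≠ []) :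
    minPeriod (v.take (minPeriod v)) = minPeriod v := by
  have hp0 := (minPeriod_spec v).1
  have hpl : minPeriod v ≤ v.length := minPeriod_le_length hv0
  have hw0 : v.take (minPeriod v) ≠ [] := by
    intro h; have := congrArg List.length h
    rw [List.length_take, min_eq_left hpl, List.length_nil] at this; omega
  have hwl : (v.take (minPeriod v)).length = minPeriod v := by
    rw [List.length_take, min_eq_left hpl]
  obtain ⟨hd0, hd, -⟩ := minPeriod_spec (v.take (minPeriod v))
  refine le_antisymm (le_of_le_of_eq (minPeriod_le_length hw0) hwl) ?_
  by_contra hlt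
  push Not at hlt
  exact hv.not_hasPeriod_take_minPeriod hd0 hlt hd

/-! ### Lemma 13.15 (2): `u` suffix of `w` iff `period(x) = period(v)` -/

omit [LinearOrder α] in
/-- The smallest period of `x = u v` is at least the smallest period of its suffix `v`.
[cite: CrochemoreRytter1994, Lemma 13.15 (proof of (2))] -/
theorem minPeriod_le_minPeriod_append (u v : List α) : minPeriod v ≤ minPeriod (u ++ v) :=
  (minPeriod_spec v).2.2 _ (minPeriod_spec (u ++ v)).1
    ((minPeriod_spec (u ++ v)).2.1.infix ⟨u, [], by rw [List.append_nil]⟩)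

/-- **Lemma 13.15 (2)** (with its converse): for `x = u v ≠ ε`, `v = Maxsuf(x)`, `p = period(v)`,
`w = v[0..p)`: `u` is a suffix of `w` **iff** `period(x) = period(v)` ("⇒": `x` is then a factor of
a power of `w`; "⇐": by (3), `|u| < period(x) = p`, and period `p` of `x` reads `u` inside `w`).
[cite: CrochemoreRytter1994, Lemma 13.15 (2)] -/
theorem IsMaxSuffix.suffix_take_minPeriod_iff {u v : List α} (hv : IsMaxSuffix (u ++ v) v)
    (hx : u ++ v ≠ []) : u <:+ v.take (minPeriod v) ↔ minPeriod (u ++ v) = minPeriod v := by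
  obtain ⟨hp0, hp, -⟩ := minPeriod_spec v
  obtain ⟨hq0, hq, hqmin⟩ := minPeriod_spec (u ++ v)
  have hv0 : v ≠ [] := hv.ne_nil hx
  have hpl : minPeriod v ≤ v.length := minPeriod_le_length hv0
  have h3 : u.length < minPeriod (u ++ v) := hv.length_lt_minPeriod
  have hpq : minPeriod v ≤ minPeriod (u ++ v) := minPeriod_le_minPeriod_append u v
  set p := minPeriod v with hp_def
  set q := minPeriod (u ++ v) with hq_def
  have hwl : (v.take p).length = p := by rw [List.length_take, min_eq_left hpl]
  constructor
  · intro hsuf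
    have hul : u.length ≤ p := hwl ▸ hsuf.length_le
    refine le_antisymm (hqmin p hp0 ?_) hpq
    rw [List.hasPeriod_iff_getElem?]
    intro i hi
    rw [List.length_append] at hi
    by_cases hiu : i < u.length
    · rw [List.getElem?_append_left hiu, List.getElem?_append_right (by omega)]
      obtain ⟨t, ht⟩ := hsuf
      have htl : t.length = p - u.length := by
        have := congrArg List.length ht
        rw [List.length_append, hwl] at this; omega
      have h1 : (v.take p)[t.length + i]? = u[i]? := by
        rw [← ht, List.getElem?_append_right (by omega), Nat.add_sub_cancel_left]
      rw [← h1, List.getElem?_take, if_pos (by omega), htl]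
      congr 1; omega
    · push Not at hiu
      rw [List.getElem?_append_right hiu, List.getElem?_append_right (by omega),
        List.hasPeriod_iff_getElem?.mp hp (i - u.length) (by omega)]
      congr 1; omega
  · intro hqp
    have hup : u.length < p := hqp ▸ h3
    have hper := List.hasPeriod_iff_getElem?.mp hq
    suffices hu : u = (v.take p).drop (p - u.length) by rw [hu]; exact List.drop_suffix _ _
    apply List.ext_getElem?
    intro i
    rw [List.getElem?_drop, List.getElem?_take]
    by_cases hi : i < u.length
    · rw [if_pos (by omega)]
      have h1 := hper i (by rw [List.length_append]; omega)
      rw [List.getElem?_append_left hi, List.getElem?_append_right (by omega)] at h1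
      rw [h1, hqp]; congr 1; omega
    · rw [if_neg (by omega)]
      exact List.getElem?_eq_none (by omega)

/-- For `x = u v ≠ ε`, `v = Maxsuf(x)`: if `u` is not a suffix of `w = v[0..period(v))` then
`period(v) < period(x)`. [cite: CrochemoreRytter1994, Lemma 13.15 (2)] -/
theorem IsMaxSuffix.minPeriod_lt_minPeriod_of_not_suffix {u v : List α} (hv : IsMaxSuffix (u ++ v) v)
    (hx : u ++ v ≠ []) (hns : ¬ u <:+ v.take (minPeriod v)) : minPeriod v < minPeriod (u ++ v) :=
  lt_of_le_of_ne (minPeriod_le_minPeriod_append u v)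
    (fun h => hns ((hv.suffix_take_minPeriod_iff hx).mpr h.symm))

/-! ### Lemma 13.15 (4) and (5) -/

/-- **Lemma 13.15 (4)**: for `x = u v`, `v = Maxsuf(x) ≠ ε`: if `|u| ≥ period(v)` then
`period(x) > |v|` (a period `|u| < q ≤ |v|` puts `u` inside `v` across a multiple of `period(v)`,
and the piece of `u` after it is a nonempty suffix of `u` and a prefix of `v`).
[cite: CrochemoreRytter1994, Lemma 13.15 (4)] -/
theorem IsMaxSuffix.length_lt_minPeriod_of_minPeriod_le {u v : List α} (hv : IsMaxSuffix (u ++ v) v)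
    (hv0 : v ≠ []) (hpu : minPeriod v ≤ u.length) : v.length < minPeriod (u ++ v) := by
  obtain ⟨hp0, hp, -⟩ := minPeriod_spec v
  obtain ⟨hq0, hq, -⟩ := minPeriod_spec (u ++ v)
  have hx : u ++ v ≠ [] := by simp [hv0]
  have h3 : u.length < minPeriod (u ++ v) := hv.length_lt_minPeriod
  set p := minPeriod v with hp_def
  set q := minPeriod (u ++ v) with hq_def
  by_contra hle
  push Not at hle
  have hocc : ∀ i < u.length, u[i]? = v[(q - u.length) + i]? := fun i hi =>
    getElem?_eq_of_hasPeriod_append hq h3.le hle hi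
  -- `m = p ⌊(q-1)/p⌋` is a multiple of `p` in `[q-|u|, q)`
  have hdm := Nat.div_add_mod (q - 1) p
  have hml := Nat.mod_lt (q - 1) hp0
  obtain ⟨z, hz0, hzu, hzv⟩ := exists_suffix_prefix_of_hasPeriod (m := p * ((q - 1) / p)) hp hocc
    (dvd_mul_right _ _) (by omega) (by omega) (by omega)
  exact hv.not_prefix_of_suffix hz0 hzu hzv

/-- **Lemma 13.15 (5)**: for `x = u v`, `v = Maxsuf(x) = wᵉ w'` (`|w| = p = period(v)`,
`e = ⌊|v|/p⌋`): if `u` is not a suffix of `w` and `|u| < p` then `period(x) > min(|v|, |u wᵉ|)`.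
(A period `|u| < q ≤ min(|v|, |u wᵉ|)` of `x` is either a multiple of `p` — then `u` is read inside a
full occurrence of `w` ending at `q`, so `u` is a suffix of `w` —, or `q = kp + d`, `0 < d < p`, with
`(k+1)p ≤ |v|` — then `w` has the period `d`, contradicting (1) —, or with `(k+1)p > |v|` — then
`kp ≥ q - |u|` and `v[kp..q)` is a nonempty suffix of `u` and a prefix of `v`, contradicting the key
step.) [cite: CrochemoreRytter1994, Lemma 13.15 (5)] -/
theorem IsMaxSuffix.min_lt_minPeriod {u v : List α} (hv : IsMaxSuffix (u ++ v) v)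
    (hns : ¬ u <:+ v.take (minPeriod v)) (hup : u.length < minPeriod v) :
    min v.length (u.length + minPeriod v * (v.length / minPeriod v)) < minPeriod (u ++ v) := by
  have hu0 : u ≠ [] := by rintro rfl; exact hns List.nil_suffix
  have hx : u ++ v ≠ [] := by simp [hu0]
  obtain ⟨hp0, hp, hpmin⟩ := minPeriod_spec v
  obtain ⟨hq0, hq, -⟩ := minPeriod_spec (u ++ v)
  have hv0 : v ≠ [] := hv.ne_nil hx
  have hpl : minPeriod v ≤ v.length := minPeriod_le_length hv0
  have h3 : u.length < minPeriod (u ++ v) := hv.length_lt_minPeriod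
  have h1 := fun {d : ℕ} (hd : 0 < d) (hdp : d < minPeriod v) =>
    hv.self.not_hasPeriod_take_minPeriod hd hdp
  set p := minPeriod v with hp_def
  set q := minPeriod (u ++ v) with hq_def
  by_contra hle
  push Not at hle
  have hqv : q ≤ v.length := (le_min_iff.mp hle).1
  have hqe : q ≤ u.length + p * (v.length / p) := (le_min_iff.mp hle).2
  have hocc : ∀ i < u.length, u[i]? = v[(q - u.length) + i]? := fun i hi =>
    getElem?_eq_of_hasPeriod_append hq h3.le hqv hi
  have hmod := List.hasPeriod_iff_forall_getElem?_mod.mp hp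
  have hediv := Nat.div_add_mod v.length p
  have hemod := Nat.mod_lt v.length hp0
  have hqdiv := Nat.div_add_mod q p
  have hqmod := Nat.mod_lt q hp0
  by_cases hdvd : p ∣ q
  · -- `q` a multiple of `p`: `u = v[q-|u|..q)` is a suffix of the occurrence of `w` ending at `q`
    apply hns
    obtain ⟨c, hc⟩ := hdvd
    have hc1 : 1 ≤ c := by
      rcases Nat.eq_zero_or_pos c with rfl | h
      · rw [Nat.mul_zero] at hc; omega
      · exact h
    have hsplit : p * c = p * (c - 1) + p := by
      conv_lhs => rw [show c = (c - 1) + 1 by omega, Nat.mul_succ]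
    suffices hu : u = (v.take p).drop (p - u.length) by rw [hu]; exact List.drop_suffix _ _
    apply List.ext_getElem?
    intro i
    rw [List.getElem?_drop, List.getElem?_take]
    by_cases hi : i < u.length
    · rw [if_pos (by omega), hocc i hi, hmod (q - u.length + i) (by omega),
        hmod (p - u.length + i) (by omega),
        show q - u.length + i = (p - u.length + i) + p * (c - 1) by omega,
        Nat.add_mul_mod_self_left]
    · rw [if_neg (by omega)]
      exact List.getElem?_eq_none (by omega)
  · have hd0 : 0 < q % p := Nat.pos_of_ne_zero (fun h => hdvd (Nat.dvd_of_mod_eq_zero h))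
    by_cases hfit : p * (q / p) + p ≤ v.length
    · -- `w` gets the period `d = q % p`: `w[j] = v[j] = v[j+q] = v[(j+q) mod p] = w[j+d]`
      apply h1 hd0 hqmod
      have hvq : v.HasPeriod q := hq.infix ⟨u, [], by rw [List.append_nil]⟩
      rw [List.hasPeriod_iff_getElem?]
      intro j hj
      rw [List.length_take, min_eq_left hpl] at hj
      rw [List.getElem?_take, List.getElem?_take, if_pos (by omega), if_pos (by omega),
        List.hasPeriod_iff_getElem?.mp hvq j (by omega), hmod (j + q) (by omega),
        hmod (j + q % p) (by omega), show j + q = (j + q % p) + p * (q / p) by omega,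
        Nat.add_mul_mod_self_left]
    · -- `k = ⌊q/p⌋ ≥ e`: `z = v[kp..q)` is a nonempty suffix of `u` and a prefix of `v`
      push Not at hfit
      have hkm : q - u.length ≤ p * (q / p) := by
        have hle' : v.length / p ≤ q / p := by
          by_contra hlt
          push Not at hlt
          have := Nat.mul_le_mul_left p (Nat.succ_le_of_lt hlt)
          rw [Nat.mul_succ] at this
          omega
        have := Nat.mul_le_mul_left p hle'
        omega
      obtain ⟨z, hz0, hzu, hzv⟩ := exists_suffix_prefix_of_hasPeriod (m := p * (q / p)) hp hocc
        (dvd_mul_right _ _) hkm (by omega) (by omega)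
      exact hv.not_prefix_of_suffix hz0 hzu hzv

/-! ### Lemma 13.16 and the small-period corollary -/

/-- **Lemma 13.16** (first half): for `x = u v`, `v = Maxsuf(x) = wᵉ w'`, if `u` is not a suffix of
`w` then `period(x) > max(|u|, min(|v|, |u wᵉ|))` (by Lemma 13.15 (3), (4), (5)).
[cite: CrochemoreRytter1994, Lemma 13.16] -/
theorem IsMaxSuffix.max_lt_minPeriod {u v : List α} (hv : IsMaxSuffix (u ++ v) v)
    (hns : ¬ u <:+ v.take (minPeriod v)) :
    max u.length (min v.length (u.length + minPeriod v * (v.length / minPeriod v)))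
      < minPeriod (u ++ v) := by
  have hu0 : u ≠ [] := by rintro rfl; exact hns List.nil_suffix
  have hx : u ++ v ≠ [] := by simp [hu0]
  have hv0 : v ≠ [] := hv.ne_nil hx
  refine max_lt (hv.length_lt_minPeriod) ?_
  rcases Nat.lt_or_ge u.length (minPeriod v) with hup | hpu
  · exact hv.min_lt_minPeriod hns hup
  · exact lt_of_le_of_lt (min_le_left _ _) (hv.length_lt_minPeriod_of_minPeriod_le hv0 hpu)

/-- **Lemma 13.16** (second half): the maximum above is `≥ |x|/2`, hence if `u` is not a suffix of
`w` then `|x| < 2 period(x)` — after a complete match the one-way algorithm may shift by `|x|/2`.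
[cite: CrochemoreRytter1994, Lemma 13.16] -/
theorem IsMaxSuffix.length_lt_two_mul_minPeriod {u v : List α} (hv : IsMaxSuffix (u ++ v) v)
    (hns : ¬ u <:+ v.take (minPeriod v)) : (u ++ v).length < 2 * minPeriod (u ++ v) := by
  have hM := hv.max_lt_minPeriod hns
  have hu0 : u ≠ [] := by rintro rfl; exact hns List.nil_suffix
  have hx : u ++ v ≠ [] := by simp [hu0]
  have hv0 : v ≠ [] := hv.ne_nil hx
  have hp0 := (minPeriod_spec v).1
  have hpl : minPeriod v ≤ v.length := minPeriod_le_length hv0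
  set p := minPeriod v with hp_def
  have hediv := Nat.div_add_mod v.length p
  have hemod := Nat.mod_lt v.length hp0
  have he1 : p ≤ p * (v.length / p) := Nat.le_mul_of_pos_right p (Nat.div_pos hpl hp0)
  have ha := (max_lt_iff.mp hM).1
  have hb := min_lt_iff.mp (max_lt_iff.mp hM).2
  rw [List.length_append]
  omega

/-- **Small-period corollary** (contrapositive of Lemma 13.16, used by the searching phase): for
`x = u v`, `v = Maxsuf(x)`: if `2 period(x) ≤ |x|` then `u` is a suffix of `w = v[0..period(v))` and
`period(x) = period(v)`. [cite: CrochemoreRytter1994, Lemma 13.16] -/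
theorem IsMaxSuffix.suffix_take_minPeriod_of_two_mul_le {u v : List α} (hv : IsMaxSuffix (u ++ v) v)
    (h : 2 * minPeriod (u ++ v) ≤ (u ++ v).length) :
    u <:+ v.take (minPeriod v) ∧ minPeriod (u ++ v) = minPeriod v := by
  have hsuf : u <:+ v.take (minPeriod v) := by
    by_contra hns
    exact absurd h (not_le.mpr (hv.length_lt_two_mul_minPeriod hns))
  have hx : u ++ v ≠ [] := by
    intro h0
    have h1 := (minPeriod_spec (u ++ v)).1
    rw [h0, List.length_nil] at h
    rw [h0] at h1
    omega
  exact ⟨hsuf, (hv.suffix_take_minPeriod_iff hx).mp hsuf⟩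

end MaxSuffix

/-! ### The examples of §13.6 (letters `a < b < c` are `0 < 1 < 2`) -/

section Examples

/-- `List.HasPeriod` is decidable (it is a prefix test); used by the examples. [folklore] -/
private instance instDecidableHasPeriod (w : List ℕ) (p : ℕ) : Decidable (w.HasPeriod p) :=
  inferInstanceAs (Decidable (w <+: List.take p w ++ w))

/-- `x = aaaaba`: MS-factorisation `u = aaaa`, `v = Maxsuf(x) = ba = w`, `e = 1`, `w' = ε`; `u` is not
a suffix of `w`, `|u| ≥ period(v) = 2`, and `period(x) = 5 = |u| + 1`: the bound of Lemma 13.15 (3)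
is attained. [cite: CrochemoreRytter1994, §13.6 Example (bounds of Lemma 13.15, case (3))] -/
example : IsMaxSuffix ([0,0,0,0,1,0] : List ℕ) [1,0] ∧ ¬ ([0,0,0,0] : List ℕ) <:+ [1,0] ∧
    minPeriod ([1,0] : List ℕ) = 2 ∧ minPeriod ([0,0,0,0,1,0] : List ℕ) = 5 := by
  rw [minPeriod_eq_length_sub_length_border (by decide),
    minPeriod_eq_length_sub_length_border (by decide)]
  decide

/-- `x = aababa`: `u = aa`, `v = baba`, `w = ba`, `e = 2`, `w' = ε`; `|u| = 2 ≥ period(v) = 2` and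
`period(x) = 5 = |v| + 1`: the bound of Lemma 13.15 (4) is attained.
[cite: CrochemoreRytter1994, §13.6 Example (bounds of Lemma 13.15, case (4))] -/
example : IsMaxSuffix ([0,0,1,0,1,0] : List ℕ) [1,0,1,0] ∧
    minPeriod ([1,0,1,0] : List ℕ) = 2 ∧ minPeriod ([0,0,1,0,1,0] : List ℕ) = 5 := by
  rw [minPeriod_eq_length_sub_length_border (by decide),
    minPeriod_eq_length_sub_length_border (by decide)]
  decide

/-- `x = acabca`: `u = a`, `v = cabca`, `w = cab`, `e = 1`, `w' = ca`; `u` is not a suffix of `w`,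
`|u| = 1 < period(v) = 3`, `min(|v|, |u wᵉ|) = min(5, 4) = 4` and `period(x) = 5`: the bound of
Lemma 13.15 (5) is attained with the minimum at `|u wᵉ|`.
[cite: CrochemoreRytter1994, §13.6 Example (bounds of Lemma 13.15, case (5), x = acabca)] -/
example : IsMaxSuffix ([0,2,0,1,2,0] : List ℕ) [2,0,1,2,0] ∧ ¬ ([0] : List ℕ) <:+ [2,0,1] ∧
    minPeriod ([2,0,1,2,0] : List ℕ) = 3 ∧ minPeriod ([0,2,0,1,2,0] : List ℕ) = 5 := by
  rw [minPeriod_eq_length_sub_length_border (by decide),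
    minPeriod_eq_length_sub_length_border (by decide)]
  decide

/-- `x = ababbbab`: `u = aba`, `v = bbbab`, `w = bbba`, `e = 1`, `w' = b`; `u` is not a suffix of `w`,
`|u| = 3 < period(v) = 4`, `min(|v|, |u wᵉ|) = min(5, 7) = 5` and `period(x) = 6`: the bound of
Lemma 13.15 (5) is attained with the minimum at `|v|`.
[cite: CrochemoreRytter1994, §13.6 Example (bounds of Lemma 13.15, case (5), x = ababbbab)] -/
example : IsMaxSuffix ([0,1,0,1,1,1,0,1] : List ℕ) [1,1,1,0,1] ∧ ¬ ([0,1,0] : List ℕ) <:+ [1,1,1,0] ∧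
    minPeriod ([1,1,1,0,1] : List ℕ) = 4 ∧ minPeriod ([0,1,0,1,1,1,0,1] : List ℕ) = 6 := by
  rw [minPeriod_eq_length_sub_length_border (by decide),
    minPeriod_eq_length_sub_length_border (by decide)]
  decide

/-- `x = babbbabbbab` (the example of informal algorithm P): `u = ba`, `v = bbbabbbab`, `w = bbba`,
`e = 2`, `w' = b`; here `u` **is** a suffix of `w` and `period(x) = period(v) = 4` (Lemma 13.15 (2)),
and `2 period(x) ≤ |x| = 11`. [cite: CrochemoreRytter1994, §13.6 Example (algorithm P on x = babbbabbbab)] -/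
example : IsMaxSuffix ([1,0,1,1,1,0,1,1,1,0,1] : List ℕ) [1,1,1,0,1,1,1,0,1] ∧
    ([1,0] : List ℕ) <:+ [1,1,1,0] ∧ minPeriod ([1,1,1,0,1,1,1,0,1] : List ℕ) = 4 ∧
    minPeriod ([1,0,1,1,1,0,1,1,1,0,1] : List ℕ) = 4 := by
  rw [minPeriod_eq_length_sub_length_border (by decide),
    minPeriod_eq_length_sub_length_border (by decide)]
  decide

/-- The border-freeness of `w` (Lemma 13.15 (1)) on `v = bbbabbbab`: `w = bbba` has no period
`1, 2, 3`. [cite: CrochemoreRytter1994, Lemma 13.15 (1) (example v = bbbabbbab)] -/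
example : ¬ ([1,1,1,0] : List ℕ).HasPeriod 1 ∧ ¬ ([1,1,1,0] : List ℕ).HasPeriod 2 ∧
    ¬ ([1,1,1,0] : List ℕ).HasPeriod 3 ∧ ([1,1,1,0] : List ℕ).HasPeriod 4 := by
  decide

end Examples

end Literature.Combinatorics.Words
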